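import Literature.NumberTheory.LFunctions.IwaniecSarnakFamilyWeightTwoPetersson
import Literature.NumberTheory.LFunctions.KowalskiMichelPeterssonFormula
import HarnessLib

/-!
# The weight-2 prime-level even share from the Petersson fact alone — re-threaded over the
# REPAIRED Petersson fact `kowalskiMichel2000_peterssonBound` (R2-G44 twins, suffix `_pb`)

Topic `Literature/NumberTheory/LFunctions` (namespace
`Literature.NumberTheory.LFunctions.CentralValueFamilyHalfEdge`). PROOFS only — no definition, no
named fact (D-0026). Cell `landau-siegel`, F-S3, re-thread file **F2** of the R2-G44 repair
(director-frontier split of record 2026-08-27T11:56:05Z).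

`IwaniecSarnakFamilyWeightTwoPetersson.lean` derives the weight-2 prime-level even share and the two
four-fact decision theorems from the Literature fact `KowalskiMichel2000.kowalskiMichel2000_petersson`
(Kowalski–Michel 2000, p. 310, display after (16), typed for ALL `m, n ≥ 1`). That fact is FALSE AS
TYPED (`KowalskiMichel2000.not_kowalskiMichel2000_petersson`, witness `(m, n) = (q, q)`;
refuted-as-typed ≠ refuted-in-print), so those theorems are vacuous as stated. This file lands their
TWINS over the repaired fact `KowalskiMichel2000.kowalskiMichel2000_peterssonBound` (same display with
the print's side condition `¬ (q ∣ m ∧ q ∣ n)`, Kowalski–Michel p. 312 (23) "since `(m, q) = 1`"),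
proofs verbatim up to one side goal per instantiation — here `(q, 1)` and `(1, 1)`, both closed by
`KowalskiMichel2000.not_dvd_and_dvd_one` (a prime does not divide `1`). Landed declarations are
untouched; nothing here uses the negative lemma (no ex falso).

* `abs_two_mul_evenMass_sub_totalMass_le_pb` — `|2·even − total| ≤ C q^{−1/4}` (instantiation `(q,1)`);
* `abs_totalMass_sub_one_le_pb` — `|Σʰ 1 − 1| ≤ C q^{−3/2}` (instantiation `(1,1)`);
* `evenShare_primeLevelFamilyTwo_of_petersson_pb` — `primeLevelFamilyTwo.EvenShare` from the repaired
  fact ALONE;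
* `lOne_lowerBound_of_untwistedProportion_weightTwo'_pb`, `lOne_lowerBound_of_EStarFam_prime_weightTwo'_pb`
  — the four-fact weight-2 decision theorems (the leaf glue of the family route) over
  `lapidRallis2003_theorem1_gl2Twist`, `iwaniec2006_twistedHalf`, `iwaniec2006_mixedMomentOverMass`
  and the REPAIRED Petersson fact.

WHAT THIS IS NOT: no claim that the edge holds; nothing about Landau–Siegel zeros. «The programme
SEARCHES and TYPES; no claim about Landau–Siegel zeros, Theorems 1–2 of arXiv:2211.02515 or a
repaired Margin232 until a kernel theorem says so.»

## References

* [KowalskiMichel2000] E. Kowalski, P. Michel, Acta Arith. 94 (2000), §2.3 p. 310 (display after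
  (16)) and §2.4.2 p. 312 (23) — typed (repaired) `KowalskiMichel2000.kowalskiMichel2000_peterssonBound`.
* [IwaniecKowalski2004] §14, before Prop. 14.25 (`ε_f = ∓ q^{1/2}λ_f(q)`) — tree theorem
  `IwaniecSarnak.rootNumber_eq_prime_level_weightTwo`.
* [IwaniecConversations2006] §7 (7.3)–(7.7), p. 97.
-/

noncomputable section

namespace Literature.NumberTheory.LFunctions.CentralValueFamilyHalfEdge

open scoped MatrixGroups
open Finset Real CongruenceSubgroup Complex
open Literature.NumberTheory.EllipticCurves.ModularForms
open Literature.NumberTheory.LFunctions.IwaniecSarnak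

section WeightTwo

/-- **The root-number sum is small** (repaired-fact twin): `|2·even − total| ≤ C·q^{−1/4}` over
`H_2(q)` for every prime `q`, from the repaired Petersson fact at `(m,n) = (q,1)` — side condition
`¬ (q ∣ q ∧ q ∣ 1)` — with `ε = ¼` (`δ(q,1) = 0`, `q^{1/2}·q^{3/4}·q^{−3/2} = q^{−1/4}`).
[cite: KowalskiMichel2000, §2.3 (display after (16)) with §2.4.2 (23)] -/
theorem abs_two_mul_evenMass_sub_totalMass_le_pb
    (hP : KowalskiMichel2000.kowalskiMichel2000_peterssonBound) :
    ∃ C : ℝ, ∀ (q : ℕ) [NeZero q], q.Prime →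
      |2 * harmonicSum q 2 (fun f => if rootNumber f = 1 then (1 : ℝ) else 0) -
          harmonicSum q 2 (fun _ => (1 : ℝ))| ≤ C * (q : ℝ) ^ (-(1 / 4 : ℝ)) := by
  obtain ⟨C, hC⟩ := hP (1 / 4) (by norm_num)
  refine ⟨C, fun q _ hq => ?_⟩
  have h := hC q hq q 1 hq.one_lt.le le_rfl (KowalskiMichel2000.not_dvd_and_dvd_one hq q)
  rw [if_neg hq.one_lt.ne', sub_zero] at h
  have hqpos : (0 : ℝ) < q := by exact_mod_cast hq.pos
  have hid := two_mul_evenMass_eq_weightTwo q hq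
  have e : ((2 * harmonicSum q 2 (fun f => if rootNumber f = 1 then (1 : ℝ) else 0) -
      harmonicSum q 2 (fun _ => (1 : ℝ)) : ℝ) : ℂ) = (Real.sqrt q : ℂ) * KowalskiMichel2000.pet q q 1 := by
    push_cast at hid ⊢
    rw [hid]; ring
  rw [← Real.norm_eq_abs, ← Complex.norm_real, e, norm_mul, Complex.norm_real, Real.norm_eq_abs,
    abs_of_nonneg (Real.sqrt_nonneg _)]
  have hrhs : Real.sqrt q * (C * (((q : ℝ) * (1 : ℕ)) ^ (1 / 2 + 1 / 4 : ℝ)) * (q : ℝ) ^ (-(3 / 2 : ℝ))) =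
      C * (q : ℝ) ^ (-(1 / 4 : ℝ)) := by
    rw [Nat.cast_one, mul_one, Real.sqrt_eq_rpow]
    have : (q : ℝ) ^ (1 / 2 : ℝ) * ((q : ℝ) ^ (1 / 2 + 1 / 4 : ℝ) * (q : ℝ) ^ (-(3 / 2 : ℝ))) =
        (q : ℝ) ^ (-(1 / 4 : ℝ)) := by
      rw [← Real.rpow_add hqpos, ← Real.rpow_add hqpos]; norm_num
    calc (q : ℝ) ^ (1 / 2 : ℝ) * (C * (q : ℝ) ^ (1 / 2 + 1 / 4 : ℝ) * (q : ℝ) ^ (-(3 / 2 : ℝ)))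
        = C * ((q : ℝ) ^ (1 / 2 : ℝ) * ((q : ℝ) ^ (1 / 2 + 1 / 4 : ℝ) * (q : ℝ) ^ (-(3 / 2 : ℝ)))) := by
          ring
      _ = C * (q : ℝ) ^ (-(1 / 4 : ℝ)) := by rw [this]
  rw [← hrhs]
  exact mul_le_mul_of_nonneg_left h (Real.sqrt_nonneg _)

/-- **Total harmonic mass at prime level, weight `2`** (repaired-fact twin): `|Σʰ_{f ∈ H_2(q)} 1 − 1|
≤ C·q^{−3/2}` for every prime `q`, from the repaired Petersson fact at `(1,1)` — side condition
`¬ (q ∣ 1 ∧ q ∣ 1)` (`λ_f(1) = 1`). [cite: KowalskiMichel2000, §2.3 (display after (16)) with §2.4.2 (23)] -/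
theorem abs_totalMass_sub_one_le_pb (hP : KowalskiMichel2000.kowalskiMichel2000_peterssonBound) :
    ∃ C : ℝ, ∀ (q : ℕ) [NeZero q], q.Prime →
      |harmonicSum q 2 (fun _ => (1 : ℝ)) - 1| ≤ C * (q : ℝ) ^ (-(3 / 2 : ℝ)) := by
  obtain ⟨C, hC⟩ := hP 1 one_pos
  refine ⟨C, fun q _ hq => ?_⟩
  have h := hC q hq 1 1 le_rfl le_rfl (KowalskiMichel2000.not_dvd_and_dvd_one hq 1)
  rw [pet_one_one, if_pos rfl] at h
  have e : (((harmonicSum q 2 (fun _ => (1 : ℝ)) : ℝ) : ℂ) - 1) =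
      (((harmonicSum q 2 (fun _ => (1 : ℝ)) - 1 : ℝ)) : ℂ) := by push_cast; ring
  rw [e, Complex.norm_real, Real.norm_eq_abs] at h
  simpa using h

/-- `t ≤ x^{1/4}` as soon as `t ≥ 0` and `t⁴ ≤ x`. [folklore] -/
private theorem le_rpow_quarter' {t x : ℝ} (ht : 0 ≤ t) (h : t ^ 4 ≤ x) : t ≤ x ^ (1 / 4 : ℝ) := by
  have h4 : (0 : ℝ) ≤ t ^ 4 := by positivity
  have hmono := Real.rpow_le_rpow h4 h (by norm_num : (0 : ℝ) ≤ 1 / 4)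
  have e : (t ^ 4) ^ (1 / 4 : ℝ) = t := by
    rw [show (1 / 4 : ℝ) = ((4 : ℕ) : ℝ)⁻¹ by norm_num]
    exact Real.pow_rpow_inv_natCast ht (by norm_num)
  rwa [e] at hmono

/-- **Even share at prime level, weight `2`, from the REPAIRED Petersson fact alone**: for all large
primes `q`, `Σ^h_{w_f=1} ω_f ≥ (1/5)·Σ^h ω_f` and `Σ^h ω_f > 0` over `H_2(q)` — total mass
`∈ [7/8, 9/8]` (the fact at `(1,1)`), `|2·even − total| ≤ 1/8` (the fact at `(q,1)`), so
`even ≥ 3/8 ≥ total/5` (twin of `evenShare_primeLevelFamilyTwo_of_petersson`).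
[cite: KowalskiMichel2000, §2.3 (display after (16)) with §2.4.2 (23)] -/
theorem evenShare_primeLevelFamilyTwo_of_petersson_pb
    (hP : KowalskiMichel2000.kowalskiMichel2000_peterssonBound) : primeLevelFamilyTwo.EvenShare := by
  obtain ⟨C₁, hT⟩ := abs_totalMass_sub_one_le_pb hP
  obtain ⟨C₂, hE⟩ := abs_two_mul_evenMass_sub_totalMass_le_pb hP
  set M : ℝ := max C₂ 0 with hMdef
  have hM : 0 ≤ M := le_max_right _ _
  refine ⟨1 / 5, by norm_num, max (max (8 * C₁) ((8 * M) ^ 4)) 1,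
    fun (N : ℕ+) (hadm : Squarefree (N : ℕ) ∧ (N : ℕ).Prime)
      (hsz : max (max (8 * C₁) ((8 * M) ^ 4)) 1 ≤ ((N : ℕ) : ℝ)) => ?_⟩
  obtain ⟨_, hprime⟩ := hadm
  show 1 / 5 * (iwaniecSarnakFamily 2).totalMass N ≤ (iwaniecSarnakFamily 2).evenMass N ∧
    0 < (iwaniecSarnakFamily 2).totalMass N
  rw [totalMass_iwaniecSarnakFamily, evenMass_iwaniecSarnakFamily]
  set q : ℕ := (N : ℕ) with hqdef
  have hq1 : (1 : ℝ) ≤ q := le_trans (le_max_right _ _) hsz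
  have hqpos : (0 : ℝ) < q := lt_of_lt_of_le one_pos hq1
  have h8 : 8 * C₁ ≤ q := le_trans (le_trans (le_max_left _ _) (le_max_left _ _)) hsz
  have h4 : (8 * M) ^ 4 ≤ (q : ℝ) := le_trans (le_trans (le_max_right _ _) (le_max_left _ _)) hsz
  have hTq := hT q hprime
  have hEq := hE q hprime
  -- the total-mass error is ≤ 1/8
  have ha : C₁ * (q : ℝ) ^ (-(3 / 2 : ℝ)) ≤ 1 / 8 := by
    have hrpow : (q : ℝ) ^ (-(3 / 2 : ℝ)) ≤ (q : ℝ)⁻¹ := by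
      rw [← Real.rpow_neg_one]
      exact Real.rpow_le_rpow_of_exponent_le hq1 (by norm_num)
    have hrpos : 0 ≤ (q : ℝ) ^ (-(3 / 2 : ℝ)) := Real.rpow_nonneg hqpos.le _
    rcases le_or_gt 0 C₁ with hc | hc
    · calc C₁ * (q : ℝ) ^ (-(3 / 2 : ℝ)) ≤ C₁ * (q : ℝ)⁻¹ := mul_le_mul_of_nonneg_left hrpow hc
        _ ≤ 1 / 8 := by rw [← div_eq_mul_inv, div_le_iff₀ hqpos]; linarith
    · linarith [mul_nonpos_of_nonpos_of_nonneg hc.le hrpos]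
  -- the root-number-sum error is ≤ 1/8
  have hb : C₂ * (q : ℝ) ^ (-(1 / 4 : ℝ)) ≤ 1 / 8 := by
    have hrpos : 0 ≤ (q : ℝ) ^ (-(1 / 4 : ℝ)) := Real.rpow_nonneg hqpos.le _
    have hroot : 8 * M ≤ (q : ℝ) ^ (1 / 4 : ℝ) := le_rpow_quarter' (by positivity) h4
    have hqr : 0 < (q : ℝ) ^ (1 / 4 : ℝ) := Real.rpow_pos_of_pos hqpos _
    calc C₂ * (q : ℝ) ^ (-(1 / 4 : ℝ)) ≤ M * (q : ℝ) ^ (-(1 / 4 : ℝ)) :=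
          mul_le_mul_of_nonneg_right (le_max_left _ _) hrpos
      _ = M * ((q : ℝ) ^ (1 / 4 : ℝ))⁻¹ := by rw [Real.rpow_neg hqpos.le]
      _ ≤ 1 / 8 := by rw [mul_inv_le_iff₀ hqr]; linarith
  have hT' := abs_le.mp (le_trans hTq ha)
  have hE' := abs_le.mp (le_trans hEq hb)
  constructor
  · linarith [hT'.1, hT'.2, hE'.1, hE'.2]
  · linarith [hT'.1]

/-- **THE WEIGHT-2 DECISION THEOREM with four printed facts, repaired-Petersson twin**:
`lapidRallis2003_theorem1_gl2Twist`, `iwaniec2006_twistedHalf`, `iwaniec2006_mixedMomentOverMass`,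
the REPAIRED `kowalskiMichel2000_peterssonBound` and the EDGE `UntwistedProportion 2 (½ + η)` (`η > 0`)
imply `∃ c > 0, L(1,χ_D) ≥ c·(log D)⁻⁴` for all large `D`, all real primitive `χ mod D` (twin of
`lOne_lowerBound_of_untwistedProportion_weightTwo'`). [cite: IwaniecConversations2006, §7 (7.7) and p. 97] -/
theorem lOne_lowerBound_of_untwistedProportion_weightTwo'_pb {η : ℝ} (hη : 0 < η)
    (hLR : lapidRallis2003_theorem1_gl2Twist) (hTw : iwaniec2006_twistedHalf)
    (hMix : iwaniec2006_mixedMomentOverMass)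
    (hP : KowalskiMichel2000.kowalskiMichel2000_peterssonBound)
    (hUn : UntwistedProportion 2 (1 / 2 + η)) :
    ∃ c : ℝ, 0 < c ∧ ∃ D₀ : ℕ, ∀ (D : ℕ) [NeZero D] (χ : DirichletCharacter ℂ D), D₀ ≤ D →
      χ.IsPrimitive → MulChar.IsQuadratic χ →
        c * ((Real.log D) ^ 4)⁻¹ ≤ (χ.LFunction 1).re := by
  have hk : (2 : ℤ) ≤ 2 := le_rfl
  have hkev : Even (2 : ℤ) := ⟨1, rfl⟩
  obtain ⟨δ₁, hδ₁, htot⟩ := mixedOverTotalMass_iwaniecSarnakFamily hk hkev hMix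
  have hε : 0 < η / 4 := by positivity
  obtain ⟨δ₂, hδ₂, htw⟩ := TwistedHalf_of_twistedProportion hε (hTw 2 hk hkev)
  have hE := EStarFam_of_untwistedProportion hε hUn
  have hδ : 0 < min δ₁ δ₂ := lt_min hδ₁ hδ₂
  obtain ⟨K, hK, hsup⟩ := primeLevelFamilyTwo_compatibleSupply hδ
  have h := primeLevelFamilyTwo.lOne_lowerBound_of_EStarFam_total' hK
    (primeLevelFamilyTwo_nonnegOn hLR) (fun _ _ _ _ hcomp => CentralValueFamily.refine_compatible_B hcomp)
    (evenShare_primeLevelFamilyTwo_of_petersson_pb hP)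
    (CentralValueFamily.refine_mixedOverTotalMass (htot.anti (min_le_left _ _)))
    (CentralValueFamily.refine_twistedHalf (htw.anti (min_le_right _ _)))
    (CentralValueFamily.refine_EStarFam hE) (by linarith) hsup
  simpa only [show (2 * 2 : ℕ) = 4 from rfl] using h

/-- **The prime-level-edge form with four printed facts, repaired-Petersson twin** (the family
route's leaf glue): `lapidRallis2003_theorem1_gl2Twist`, `iwaniec2006_twistedHalf`,
`iwaniec2006_mixedMomentOverMass`, the REPAIRED `kowalskiMichel2000_peterssonBound` and the EDGE
`primeLevelFamilyTwo.EStarFam p₁ 2`, `p₁ > ½`, imply the same conclusion (twin of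
`lOne_lowerBound_of_EStarFam_prime_weightTwo'`). [cite: IwaniecConversations2006, §7 (7.7) and p. 97] -/
theorem lOne_lowerBound_of_EStarFam_prime_weightTwo'_pb
    (hLR : lapidRallis2003_theorem1_gl2Twist) (hTw : iwaniec2006_twistedHalf)
    (hMix : iwaniec2006_mixedMomentOverMass)
    (hP : KowalskiMichel2000.kowalskiMichel2000_peterssonBound)
    {p₁ : ℝ} (hp : 1 / 2 < p₁) (hE : primeLevelFamilyTwo.EStarFam p₁ 2) :
    ∃ c : ℝ, 0 < c ∧ ∃ D₀ : ℕ, ∀ (D : ℕ) [NeZero D] (χ : DirichletCharacter ℂ D), D₀ ≤ D →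
      χ.IsPrimitive → MulChar.IsQuadratic χ →
        c * ((Real.log D) ^ 4)⁻¹ ≤ (χ.LFunction 1).re := by
  have hk : (2 : ℤ) ≤ 2 := le_rfl
  have hkev : Even (2 : ℤ) := ⟨1, rfl⟩
  obtain ⟨δ₁, hδ₁, htot⟩ := mixedOverTotalMass_iwaniecSarnakFamily hk hkev hMix
  have hε : 0 < (p₁ - 1 / 2) / 2 := by linarith
  obtain ⟨δ₂, hδ₂, htw⟩ := TwistedHalf_of_twistedProportion hε (hTw 2 hk hkev)
  have hδ : 0 < min δ₁ δ₂ := lt_min hδ₁ hδ₂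
  obtain ⟨K, hK, hsup⟩ := primeLevelFamilyTwo_compatibleSupply hδ
  have h := primeLevelFamilyTwo.lOne_lowerBound_of_EStarFam_total' hK
    (primeLevelFamilyTwo_nonnegOn hLR) (fun _ _ _ _ hcomp => CentralValueFamily.refine_compatible_B hcomp)
    (evenShare_primeLevelFamilyTwo_of_petersson_pb hP)
    (CentralValueFamily.refine_mixedOverTotalMass (htot.anti (min_le_left _ _)))
    (CentralValueFamily.refine_twistedHalf (htw.anti (min_le_right _ _)))
    hE (by linarith) hsup
  simpa only [show (2 * 2 : ℕ) = 4 from rfl] using h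

end WeightTwo

end Literature.NumberTheory.LFunctions.CentralValueFamilyHalfEdge

end
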